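import Mathlib
import Summits.MatrixMultiplication.MatrixMultiplication.Theses.FourierTwoFamiliesModP

/-!
# The single-scale kill criterion for `PrimeTwoFamilies` — an explicit, elementary proof

Crux `stmt-MatrixMultiplication-14308` (`FourierTwoFamiliesModP.PrimeTwoFamilies`: CKSU 2005 Conj. 4.7 with
prime cyclic hosts), registered stub `primeTwoFamilies_false_of_singleScaleDefect` (siege k6/24, variation:
explicit / elementary route).

STATEMENT (`primeTwoFamilies_false_of_singleScaleDefect`).  If at ONE co-volume scale `γ ∈ (0,1)` there is a
power defect `c > 0` — for all primes `p ≥ p₀`, every family `(A i, B i)_{i<n}` in `ZMod p` satisfying the two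
clauses (W) (`(a - a') + (b - b') = 0` inside a pair forces `a = a'`, `b = b'`) and (X) (`a ∈ A i`, `a' ∈ A j`,
`b ∈ B j`, `b' ∈ B k`, `(a - a') + (b - b') = 0` forces `i = k`) of the simultaneous double product property,
with all co-volumes `|A i| |B i| ≥ p ^ γ`, has `n ≤ p ^ (1 - γ/2 - c)` pairs — then `PrimeTwoFamilies` fails.

PROOF (self-contained: `Mathlib` and the route file only; no product groups, no transfer theorem, no
packing lemma).  Suppose `PrimeTwoFamilies`.  Put `c₁ := min c ((1-γ/2)/2)`, `δ := min (c₁/3) ((1-γ)/2)`,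
`E := (2-δ)/γ`, and take a crux witness at slice `δ` with `n` large: `n` pairs in `ZMod p` (`p` prime),
`p ≤ n ^ (2+δ)`, co-volumes `≥ n ^ (2-δ)`.  Let `x := n ^ E`, `M := ⌊x / (4p)⌋₊` (so `x/(8p) ≤ M`, as
`x ≥ 16 p`), and let `q` be a Bertrand prime with `2pM < q ≤ 4pM ≤ x`.

THE EXPLICIT FAMILY (`M` translated integer copies of the design at spacing `2p`, read modulo `q`):
`n·M` pairs in `ZMod q` indexed by `c : Fin (n*M)` (pair `i = c.divNat`, copy `u = c.modNat < M`),
`A' c = {a.val + 2pu : a ∈ A i}`, `B' c = {b.val + 2pu : b ∈ B i}`.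
A relation `(x - x') + (y - y') = 0` in `ZMod q` between such elements with copies `u, v, v, w` lifts to the
integer `D = (a.val - a'.val + b.val - b'.val) + 2p(u - w)`, with `q ∣ D` and `|D| ≤ 2pM - 2 < q`; so `D = 0`,
and `|a.val - a'.val + b.val - b'.val| < 2p` forces `u = w` and then `(a - a') + (b - b') = 0` in `ZMod p`
(`shift_rel_nat`, `shift_rel`).  Hence (W) and (X) transfer to the new family (`padLift_W`, `padLift_X`: in
(X) the old clause gives `c.divNat = c''.divNat` and the copies give `c.modNat = c''.modNat`), and sizes are
kept (`card_padLift`).  BOOKKEEPING: `q ^ γ ≤ x ^ γ = n ^ (2-δ) ≤ |A' c| |B' c|`, while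
`8p · nM ≥ n x = n ^ (E(1-γ/2-c₁)) · n ^ (E c₁ - 3δ/2) · n ^ (2+δ) ≥ n ^ (E(1-γ/2-c₁)) · 16 · p`
by the exponent gap `E c₁ - 3δ/2 ≥ c₁/2` (and `n ^ (c₁/2) ≥ 16`), i.e. `nM ≥ 2 n ^ (E(1-γ/2-c₁)) ≥
2 x ^ (1-γ/2-c₁) ≥ 2 q ^ (1-γ/2-c)` — contradicting the defect at the prime `q ≥ p₀` (`q > 2pM ≥ x/4 ≥ n/4`).

This is an independent alternative to `CapacityLift.primeTwoFamilies_false_of_singleScaleDefect`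
(file `FourierTwoFamiliesModPPrimeTwoFamiliesCapacityEquivalences.lean`), which goes through
`stub_packingTightOfCrux` (padding in `ZMod p × ZMod M`, the carry-free transfer `exists_prime_sdpp_of_addEquiv`
and the packing lemma `card_mul_card_le_of_dpp`); here the padding and the transfer are fused into one explicit
family and the only analytic input is `tendsto_rpow_atTop`.
-/

-- single-conjunct summit: the mandated namespace repeats `MatrixMultiplication` (summit = sub-problem).
set_option linter.dupNamespace false

namespace Summit.MatrixMultiplication.MatrixMultiplication.Theorems.PrimeTwoFamilies.SingleScaleDefectElementary

open Finset
open Summit.MatrixMultiplication.MatrixMultiplication.Theses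

section Shift

variable {p q M : ℕ}

/-- The shifted copy map `a ↦ a.val + s` of `ZMod p`, read in `ZMod q`, is injective as soon as `p + s ≤ q`
(all images are naturals `< q`). -/
theorem shift_injective [NeZero p] (s : ℕ) (hq : p + s ≤ q) :
    Function.Injective (fun a : ZMod p => ((a.val + s : ℕ) : ZMod q)) := by
  intro a a' h
  have ha := a.val_lt
  have ha' := a'.val_lt
  simp only at h
  rw [ZMod.natCast_eq_natCast_iff', Nat.mod_eq_of_lt (by omega), Nat.mod_eq_of_lt (by omega)] at h
  exact ZMod.val_injective p (by omega)

/-- **The integer lift of a relation between shifted copies.**  Let `xa, xa', xb, xb' < p` be naturals and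
`u, w < M`, `v` arbitrary copy indices, and suppose `2pM ≤ q`.  If
`(xa + 2pu) - (xa' + 2pv) + ((xb + 2pv) - (xb' + 2pw)) = 0` in `ZMod q`, then the integer
`D = (xa - xa' + xb - xb') + 2p(u - w)` is divisible by `q` and has `|D| ≤ 2pM - 2 < q`, so `D = 0`; since
`|xa - xa' + xb - xb'| < 2p` this forces `u = w` and `xa - xa' + xb - xb' = 0` (in `ℤ`). -/
theorem shift_rel_nat (hq : 2 * p * M ≤ q) {xa xa' xb xb' u v w : ℕ}
    (ha : xa < p) (ha' : xa' < p) (hb : xb < p) (hb' : xb' < p) (hu : u < M) (hw : w < M)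
    (h : (((xa + 2 * p * u : ℕ) : ZMod q) - ((xa' + 2 * p * v : ℕ) : ZMod q)) +
      (((xb + 2 * p * v : ℕ) : ZMod q) - ((xb' + 2 * p * w : ℕ) : ZMod q)) = 0) :
    ((xa : ℤ) - xa') + ((xb : ℤ) - xb') = 0 ∧ u = w := by
  -- the integer lift `D` of the relation
  set D : ℤ := (((xa + 2 * p * u : ℕ) : ℤ) - ((xa' + 2 * p * v : ℕ) : ℤ)) +
    (((xb + 2 * p * v : ℕ) : ℤ) - ((xb' + 2 * p * w : ℕ) : ℤ)) with hD
  have hDval : D = ((xa : ℤ) - xa' + (xb - xb')) + 2 * p * u - 2 * p * w := by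
    rw [hD]; push_cast; ring
  have hDq : ((D : ℤ) : ZMod q) = 0 := by
    rw [hD]; push_cast at h ⊢; linear_combination h
  have hdvd : (q : ℤ) ∣ D := (ZMod.intCast_zmod_eq_zero_iff_dvd D q).1 hDq
  -- sizes, in `ℤ`
  have haZ : (xa : ℤ) < p := by exact_mod_cast ha
  have haZ' : (xa' : ℤ) < p := by exact_mod_cast ha'
  have hbZ : (xb : ℤ) < p := by exact_mod_cast hb
  have hbZ' : (xb' : ℤ) < p := by exact_mod_cast hb'
  have ha0 : (0 : ℤ) ≤ xa := by positivity
  have ha0' : (0 : ℤ) ≤ xa' := by positivity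
  have hb0 : (0 : ℤ) ≤ xb := by positivity
  have hb0' : (0 : ℤ) ≤ xb' := by positivity
  have hp0 : (0 : ℤ) ≤ p := by positivity
  have hqZ : 2 * (p : ℤ) * M ≤ q := by exact_mod_cast hq
  have huZ : (u : ℤ) + 1 ≤ M := by exact_mod_cast hu
  have hwZ : (w : ℤ) + 1 ≤ M := by exact_mod_cast hw
  have huM : (p : ℤ) * (u + 1) ≤ p * M := mul_le_mul_of_nonneg_left huZ hp0
  have hwM : (p : ℤ) * (w + 1) ≤ p * M := mul_le_mul_of_nonneg_left hwZ hp0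
  have hpu0 : (0 : ℤ) ≤ p * u := by positivity
  have hpw0 : (0 : ℤ) ≤ p * w := by positivity
  -- `|D| < q`, hence `D = 0`
  have hD0 : D = 0 := by
    refine Int.eq_zero_of_abs_lt_dvd hdvd (abs_lt.2 ⟨?_, ?_⟩)
    · rw [hDval]; linarith
    · rw [hDval]; linarith
  -- the copies agree: `u = w`
  have huw : u = w := by
    rcases lt_trichotomy u w with hlt | heq | hgt
    · exfalso
      have h1 : (u : ℤ) + 1 ≤ w := by exact_mod_cast hlt
      have h2 : (p : ℤ) * (u + 1) ≤ p * w := mul_le_mul_of_nonneg_left h1 hp0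
      have h3 : D < 0 := by rw [hDval]; linarith
      rw [hD0] at h3
      exact lt_irrefl _ h3
    · exact heq
    · exfalso
      have h1 : (w : ℤ) + 1 ≤ u := by exact_mod_cast hgt
      have h2 : (p : ℤ) * (w + 1) ≤ p * u := mul_le_mul_of_nonneg_left h1 hp0
      have h3 : 0 < D := by rw [hDval]; linarith
      rw [hD0] at h3
      exact lt_irrefl _ h3
  subst huw
  refine ⟨?_, rfl⟩
  have h0 := hD0
  rw [hDval] at h0
  linarith

/-- **Key step, in `ZMod p`.**  For `a, a', b, b' : ZMod p`, copies `u, w < M` (and any `v`) and `2pM ≤ q`: a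
relation `(a.val + 2pu) - (a'.val + 2pv) + ((b.val + 2pv) - (b'.val + 2pw)) = 0` in `ZMod q` forces the same
relation `(a - a') + (b - b') = 0` in `ZMod p` together with `u = w` (`shift_rel_nat` + `ZMod.natCast_zmod_val`). -/
theorem shift_rel [NeZero p] (hq : 2 * p * M ≤ q) (a a' b b' : ZMod p) {u v w : ℕ} (hu : u < M)
    (hw : w < M)
    (h : (((a.val + 2 * p * u : ℕ) : ZMod q) - ((a'.val + 2 * p * v : ℕ) : ZMod q)) +
      (((b.val + 2 * p * v : ℕ) : ZMod q) - ((b'.val + 2 * p * w : ℕ) : ZMod q)) = 0) :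
    (a - a') + (b - b') = 0 ∧ u = w := by
  obtain ⟨h0, huw⟩ := shift_rel_nat hq a.val_lt a'.val_lt b.val_lt b'.val_lt hu hw h
  refine ⟨?_, huw⟩
  have h1 := congrArg (Int.cast : ℤ → ZMod p) h0
  simp only [Int.cast_add, Int.cast_sub, Int.cast_natCast, Int.cast_zero, ZMod.natCast_zmod_val] at h1
  exact h1

end Shift

section Family

variable {p q n M : ℕ}

/-- **(W) transfers to the translated copies.**  If every pair `(A i, B i)` is direct in `ZMod p` (clause (W))
and `2pM ≤ q`, then every translated copy `(A' c, B' c)`, `A' c = {a.val + 2p·c.modNat : a ∈ A c.divNat}`,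
`B' c = {b.val + 2p·c.modNat : b ∈ B c.divNat}` (read in `ZMod q`), is direct: by `shift_rel` a relation in
the copy is a relation in the original pair. -/
theorem padLift_W [NeZero p] (A B : Fin n → Finset (ZMod p))
    (hW : ∀ i : Fin n, ∀ a ∈ A i, ∀ a' ∈ A i, ∀ b ∈ B i, ∀ b' ∈ B i,
      (a - a') + (b - b') = 0 → a = a' ∧ b = b')
    (hq : 2 * p * M ≤ q) (A' B' : Fin (n * M) → Finset (ZMod q))
    (hA' : ∀ c, A' c = (A c.divNat).image (fun a => ((a.val + 2 * p * (c.modNat : ℕ) : ℕ) : ZMod q)))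
    (hB' : ∀ c, B' c = (B c.divNat).image (fun a => ((a.val + 2 * p * (c.modNat : ℕ) : ℕ) : ZMod q))) :
    ∀ c : Fin (n * M), ∀ x ∈ A' c, ∀ x' ∈ A' c, ∀ y ∈ B' c, ∀ y' ∈ B' c,
      (x - x') + (y - y') = 0 → x = x' ∧ y = y' := by
  intro c x hx x' hx' y hy y' hy' h
  rw [hA'] at hx hx'
  rw [hB'] at hy hy'
  simp only [Finset.mem_image] at hx hx' hy hy'
  obtain ⟨a, ha, rfl⟩ := hx
  obtain ⟨a', ha', rfl⟩ := hx'
  obtain ⟨b, hb, rfl⟩ := hy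
  obtain ⟨b', hb', rfl⟩ := hy'
  obtain ⟨h1, -⟩ := shift_rel hq a a' b b' (c.modNat).is_lt (c.modNat).is_lt h
  obtain ⟨rfl, rfl⟩ := hW _ a ha a' ha' b hb b' hb' h1
  exact ⟨rfl, rfl⟩

/-- **(X) transfers to the translated copies.**  If the pairs `(A i, B i)` satisfy clause (X) in `ZMod p` and
`2pM ≤ q`, then so do the `n·M` translated copies in `ZMod q`: a relation `(x - x') + (y - y') = 0` with
`x ∈ A' c`, `x' ∈ A' c'`, `y ∈ B' c'`, `y' ∈ B' c''` gives, by `shift_rel`, the relation in `ZMod p` (so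
`c.divNat = c''.divNat` by (X)) and equal copies `c.modNat = c''.modNat`; hence `c = c''`. -/
theorem padLift_X [NeZero p] (A B : Fin n → Finset (ZMod p))
    (hX : ∀ i j k : Fin n, ∀ a ∈ A i, ∀ a' ∈ A j, ∀ b ∈ B j, ∀ b' ∈ B k,
      (a - a') + (b - b') = 0 → i = k)
    (hq : 2 * p * M ≤ q) (A' B' : Fin (n * M) → Finset (ZMod q))
    (hA' : ∀ c, A' c = (A c.divNat).image (fun a => ((a.val + 2 * p * (c.modNat : ℕ) : ℕ) : ZMod q)))
    (hB' : ∀ c, B' c = (B c.divNat).image (fun a => ((a.val + 2 * p * (c.modNat : ℕ) : ℕ) : ZMod q))) :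
    ∀ c c' c'' : Fin (n * M), ∀ x ∈ A' c, ∀ x' ∈ A' c', ∀ y ∈ B' c', ∀ y' ∈ B' c'',
      (x - x') + (y - y') = 0 → c = c'' := by
  intro c c' c'' x hx x' hx' y hy y' hy' h
  rw [hA'] at hx hx'
  rw [hB'] at hy hy'
  simp only [Finset.mem_image] at hx hx' hy hy'
  obtain ⟨a, ha, rfl⟩ := hx
  obtain ⟨a', ha', rfl⟩ := hx'
  obtain ⟨b, hb, rfl⟩ := hy
  obtain ⟨b', hb', rfl⟩ := hy'
  obtain ⟨h1, h2⟩ := shift_rel hq a a' b b' (c.modNat).is_lt (c''.modNat).is_lt h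
  have hdiv : c.divNat = c''.divNat := hX _ _ _ a ha a' ha' b hb b' hb' h1
  have h1' : (c : ℕ) / M = (c'' : ℕ) / M := by
    have := congrArg Fin.val hdiv
    simpa only [Fin.coe_divNat] using this
  have h2' : (c : ℕ) % M = (c'' : ℕ) % M := by simpa only [Fin.coe_modNat] using h2
  apply Fin.ext
  rw [← Nat.div_add_mod (c : ℕ) M, h1', h2', Nat.div_add_mod]

/-- Translated copies keep sizes: `|A' c| = |A c.divNat|` (the shift map is injective, `shift_injective`,
because `p + 2p·c.modNat ≤ 2pM ≤ q`). -/
theorem card_padLift [NeZero p] (A : Fin n → Finset (ZMod p)) (hq : 2 * p * M ≤ q)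
    (A' : Fin (n * M) → Finset (ZMod q))
    (hA' : ∀ c, A' c = (A c.divNat).image (fun a => ((a.val + 2 * p * (c.modNat : ℕ) : ℕ) : ZMod q)))
    (c : Fin (n * M)) : (A' c).card = (A c.divNat).card := by
  rw [hA']
  refine Finset.card_image_of_injective _ (shift_injective _ ?_)
  have hu : (c.modNat : ℕ) + 1 ≤ M := (c.modNat).is_lt
  have h1 : 2 * p * ((c.modNat : ℕ) + 1) ≤ 2 * p * M := Nat.mul_le_mul_left _ hu
  linarith

end Family

section Analysis

/-- Real powers with positive exponent are eventually large along the naturals: for `0 < e` and any `C`,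
`C ≤ n ^ e` for all large `n` (`tendsto_rpow_atTop`). -/
theorem exists_nat_le_rpow (e C : ℝ) (he : 0 < e) :
    ∃ n₁ : ℕ, ∀ n : ℕ, n₁ ≤ n → C ≤ (n : ℝ) ^ e := by
  have h := ((tendsto_rpow_atTop he).comp tendsto_natCast_atTop_atTop).eventually
    (Filter.eventually_ge_atTop C)
  obtain ⟨n₁, hn₁⟩ := Filter.eventually_atTop.1 h
  exact ⟨n₁, fun n hn => hn₁ n hn⟩

end Analysis

/-- **SINGLE-SCALE KILL CRITERION** (registered stub `primeTwoFamilies_false_of_singleScaleDefect` of crux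
`stmt-MatrixMultiplication-14308`, explicit / elementary proof).  If at ONE scale `γ ∈ (0,1)` there is a power
defect `c > 0` — for all primes `p ≥ p₀`, every family in `ZMod p` with clauses (W), (X) and all co-volumes
`≥ p ^ γ` has `n ≤ p ^ (1 - γ/2 - c)` pairs — then `PrimeTwoFamilies` (CKSU Conj. 4.7, prime cyclic hosts) is
false.  Proof: a crux witness at slice `δ = min (c₁/3) ((1-γ)/2)`, `c₁ = min c ((1-γ/2)/2)`, is replaced by
`M = ⌊n ^ ((2-δ)/γ) / (4p)⌋₊` translated integer copies at spacing `2p` inside a Bertrand prime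
`q ∈ (2pM, 4pM]` (`padLift_W`, `padLift_X`, `card_padLift`); then `q ^ γ ≤ n ^ (2-δ) ≤` co-volumes while
`n M ≥ 2 q ^ (1-γ/2-c)`, contradicting the defect at `q`.  See the module docstring for the bookkeeping. -/
theorem primeTwoFamilies_false_of_singleScaleDefect {γ c : ℝ} (hγ : 0 < γ) (hγ1 : γ < 1) (hc : 0 < c)
    (h : ∃ p₀ : ℕ, ∀ p : ℕ, p.Prime → p₀ ≤ p → ∀ (n : ℕ) (A B : Fin n → Finset (ZMod p)),
      (∀ i : Fin n, ∀ a ∈ A i, ∀ a' ∈ A i, ∀ b ∈ B i, ∀ b' ∈ B i,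
          (a - a') + (b - b') = 0 → a = a' ∧ b = b') →
      (∀ i j k : Fin n, ∀ a ∈ A i, ∀ a' ∈ A j, ∀ b ∈ B j, ∀ b' ∈ B k,
          (a - a') + (b - b') = 0 → i = k) →
      (∀ i : Fin n, (p : ℝ) ^ γ ≤ (((A i).card * (B i).card : ℕ) : ℝ)) →
      (n : ℝ) ≤ (p : ℝ) ^ (1 - γ / 2 - c)) :
    ¬ FourierTwoFamiliesModP.PrimeTwoFamilies := by
  classical
  intro hT
  obtain ⟨p₀, hp₀⟩ := h
  /- constants: `c₁`, the slice `δ`, the exponent `E` of `x = n ^ E`, and the two exponent gaps -/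
  set c₁ : ℝ := min c ((1 - γ / 2) / 2) with hc₁def
  have hc₁ : 0 < c₁ := lt_min hc (by linarith)
  have hc₁c : c₁ ≤ c := min_le_left _ _
  have hc₁g : c₁ ≤ (1 - γ / 2) / 2 := min_le_right _ _
  set δ : ℝ := min (c₁ / 3) ((1 - γ) / 2) with hδdef
  have hδ : 0 < δ := lt_min (by linarith) (by linarith)
  have hδc : δ ≤ c₁ / 3 := min_le_left _ _
  have hδγ : δ ≤ (1 - γ) / 2 := min_le_right _ _
  set E : ℝ := (2 - δ) / γ with hEdef
  have hEγ : E * γ = 2 - δ := div_mul_cancel₀ _ hγ.ne'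
  have hE1 : 1 ≤ E := by
    rw [hEdef, le_div_iff₀ hγ]
    linarith
  have hgap₁ : 1 - γ ≤ E - 2 - δ := by
    have hδ2 : δ * (1 + γ) ≤ 1 - γ := by nlinarith [mul_nonneg hδ.le (sub_nonneg.2 hγ1.le)]
    have h1 : (3 - γ + δ) * γ ≤ 2 - δ := by nlinarith [hδ2, sq_nonneg (1 - γ)]
    have h2 : 3 - γ + δ ≤ E := by rwa [hEdef, le_div_iff₀ hγ]
    linarith
  have hgap₂ : c₁ / 2 ≤ E * c₁ - 3 * δ / 2 := by
    have : c₁ ≤ E * c₁ := le_mul_of_one_le_left hc₁.le hE1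
    linarith
  set e₀ : ℝ := min (1 - γ) (c₁ / 2) with he₀def
  have he₀ : 0 < e₀ := lt_min (by linarith) (by linarith)
  obtain ⟨n₁, hn₁⟩ := exists_nat_le_rpow e₀ 16 he₀
  /- the crux witness at slice `δ` -/
  obtain ⟨n, hn, p, hp, A, B, hW, hX, hpn, hcov⟩ := hT δ hδ (max n₁ (4 * p₀ + 1))
  have hnn₁ : n₁ ≤ n := le_trans (le_max_left _ _) hn
  have hnp₀ : 4 * p₀ + 1 ≤ n := le_trans (le_max_right _ _) hn
  have hn1 : (1 : ℝ) ≤ n := by exact_mod_cast (show 1 ≤ n by omega)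
  have hn0 : (0 : ℝ) < n := by linarith
  haveI : Fact p.Prime := ⟨hp⟩
  have hp0 : (0 : ℝ) < p := by exact_mod_cast hp.pos
  have h16 : (16 : ℝ) ≤ (n : ℝ) ^ e₀ := hn₁ n hnn₁
  have h16₁ : (16 : ℝ) ≤ (n : ℝ) ^ (E - 2 - δ) :=
    h16.trans (Real.rpow_le_rpow_of_exponent_le hn1 ((min_le_left _ _).trans hgap₁))
  have h16₂ : (16 : ℝ) ≤ (n : ℝ) ^ (E * c₁ - 3 * δ / 2) :=
    h16.trans (Real.rpow_le_rpow_of_exponent_le hn1 ((min_le_right _ _).trans hgap₂))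
  /- `x = n ^ E ≥ 16 p` and the number of copies `M = ⌊x / (4p)⌋₊`, `x ≤ 8 p M` -/
  set x : ℝ := (n : ℝ) ^ E with hxdef
  have hx0 : 0 < x := Real.rpow_pos_of_pos hn0 _
  have hnδ0 : (0 : ℝ) ≤ (n : ℝ) ^ (2 + δ) := Real.rpow_nonneg hn0.le _
  have hxsplit : x = (n : ℝ) ^ (E - 2 - δ) * (n : ℝ) ^ (2 + δ) := by
    rw [hxdef, ← Real.rpow_add hn0]
    congr 1
    ring
  have hxp : 16 * (p : ℝ) ≤ x :=
    calc 16 * (p : ℝ) ≤ 16 * (n : ℝ) ^ (2 + δ) := by linarith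
      _ ≤ (n : ℝ) ^ (E - 2 - δ) * (n : ℝ) ^ (2 + δ) := mul_le_mul_of_nonneg_right h16₁ hnδ0
      _ = x := hxsplit.symm
  have h4p : (0 : ℝ) < 4 * p := by positivity
  set M : ℕ := ⌊x / (4 * p)⌋₊ with hMdef
  have hMle : (M : ℝ) * (4 * p) ≤ x := by
    rw [← le_div_iff₀ h4p]
    exact Nat.floor_le (div_nonneg hx0.le h4p.le)
  have hMge : x ≤ (M : ℝ) * (8 * p) := by
    have h1 : x / (4 * p) < (M : ℝ) + 1 := Nat.lt_floor_add_one _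
    have h2 : x < ((M : ℝ) + 1) * (4 * p) := (div_lt_iff₀ h4p).1 h1
    nlinarith
  have hM0 : 0 < M := by
    rcases Nat.eq_zero_or_pos M with h0 | h0
    · exfalso
      rw [h0] at hMge
      push_cast at hMge
      linarith
    · exact h0
  /- a Bertrand prime `q ∈ (2pM, 4pM]` -/
  have h2pM : 0 < 2 * p * M := Nat.mul_pos (Nat.mul_pos (by norm_num) hp.pos) hM0
  obtain ⟨q, hq, hltq, hqle⟩ := Nat.exists_prime_lt_and_le_two_mul (2 * p * M) h2pM.ne'
  haveI : Fact q.Prime := ⟨hq⟩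
  have hq2 : 2 * p * M ≤ q := hltq.le
  have hq0 : (0 : ℝ) ≤ q := Nat.cast_nonneg q
  have hq1 : (1 : ℝ) ≤ q := by exact_mod_cast hq.one_lt.le
  have hqx : (q : ℝ) ≤ x := by
    have h1 : (q : ℝ) ≤ ((2 * (2 * p * M) : ℕ) : ℝ) := by exact_mod_cast hqle
    push_cast at h1
    nlinarith [hMle]
  have hp₀q : p₀ ≤ q := by
    have hxn : (n : ℝ) ≤ x :=
      calc (n : ℝ) = (n : ℝ) ^ (1 : ℝ) := (Real.rpow_one _).symm
        _ ≤ x := Real.rpow_le_rpow_of_exponent_le hn1 hE1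
    have h1 : ((4 * p₀ + 1 : ℕ) : ℝ) ≤ n := by exact_mod_cast hnp₀
    have h2 : ((2 * p * M : ℕ) : ℝ) < q := by exact_mod_cast hltq
    push_cast at h1 h2
    have h3 : (p₀ : ℝ) < q := by nlinarith [hMge]
    exact_mod_cast h3.le
  /- the explicit family: `M` translated copies at spacing `2p`, read in `ZMod q` -/
  set A' : Fin (n * M) → Finset (ZMod q) :=
    fun c => (A c.divNat).image (fun a => ((a.val + 2 * p * (c.modNat : ℕ) : ℕ) : ZMod q)) with hA'
  set B' : Fin (n * M) → Finset (ZMod q) :=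
    fun c => (B c.divNat).image (fun a => ((a.val + 2 * p * (c.modNat : ℕ) : ℕ) : ZMod q)) with hB'
  have hA'c : ∀ c, A' c =
      (A c.divNat).image (fun a => ((a.val + 2 * p * (c.modNat : ℕ) : ℕ) : ZMod q)) := fun _ => rfl
  have hB'c : ∀ c, B' c =
      (B c.divNat).image (fun a => ((a.val + 2 * p * (c.modNat : ℕ) : ℕ) : ZMod q)) := fun _ => rfl
  have hW' := padLift_W A B hW hq2 A' B' hA'c hB'c
  have hX' := padLift_X A B hX hq2 A' B' hA'c hB'c
  have hcov' : ∀ c : Fin (n * M), (q : ℝ) ^ γ ≤ (((A' c).card * (B' c).card : ℕ) : ℝ) := by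
    intro c
    rw [card_padLift A hq2 A' hA'c c, card_padLift B hq2 B' hB'c c]
    calc (q : ℝ) ^ γ ≤ x ^ γ := Real.rpow_le_rpow hq0 hqx hγ.le
      _ = (n : ℝ) ^ (2 - δ) := by rw [hxdef, ← Real.rpow_mul hn0.le, hEγ]
      _ ≤ _ := hcov _
  /- the defect at `q` -/
  have hdef := hp₀ q hq hp₀q (n * M) A' B' hW' hX' hcov'
  /- upper bound: `q ^ (1-γ/2-c) ≤ q ^ (1-γ/2-c₁) ≤ x ^ (1-γ/2-c₁) = n ^ (E(1-γ/2-c₁)) =: Y` -/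
  have hθ0 : 0 ≤ 1 - γ / 2 - c₁ := by linarith
  have hup : (q : ℝ) ^ (1 - γ / 2 - c) ≤ (n : ℝ) ^ (E * (1 - γ / 2 - c₁)) :=
    calc (q : ℝ) ^ (1 - γ / 2 - c) ≤ (q : ℝ) ^ (1 - γ / 2 - c₁) :=
          Real.rpow_le_rpow_of_exponent_le hq1 (by linarith)
      _ ≤ x ^ (1 - γ / 2 - c₁) := Real.rpow_le_rpow hq0 hqx hθ0
      _ = (n : ℝ) ^ (E * (1 - γ / 2 - c₁)) := by rw [hxdef, ← Real.rpow_mul hn0.le]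
  /- lower bound: `8p · nM ≥ n x = Y · n ^ (E c₁ - 3δ/2) · n ^ (2+δ) ≥ Y · 16 · p` -/
  have hY0 : 0 < (n : ℝ) ^ (E * (1 - γ / 2 - c₁)) := Real.rpow_pos_of_pos hn0 _
  have hexp : 1 + E = E * (1 - γ / 2 - c₁) + (E * c₁ - 3 * δ / 2) + (2 + δ) := by
    linear_combination (1 / 2 : ℝ) * hEγ
  have hnx : (n : ℝ) * x =
      (n : ℝ) ^ (E * (1 - γ / 2 - c₁)) * (n : ℝ) ^ (E * c₁ - 3 * δ / 2) * (n : ℝ) ^ (2 + δ) := by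
    rw [← Real.rpow_add hn0, ← Real.rpow_add hn0, ← hexp, Real.rpow_add hn0, Real.rpow_one, hxdef]
  have key : (n : ℝ) ^ (E * (1 - γ / 2 - c₁)) * (16 * p) ≤ ((n * M : ℕ) : ℝ) * (8 * p) :=
    calc (n : ℝ) ^ (E * (1 - γ / 2 - c₁)) * (16 * p)
        ≤ (n : ℝ) ^ (E * (1 - γ / 2 - c₁)) *
            ((n : ℝ) ^ (E * c₁ - 3 * δ / 2) * (n : ℝ) ^ (2 + δ)) := by
          refine mul_le_mul_of_nonneg_left ?_ hY0.le
          calc (16 : ℝ) * p ≤ 16 * (n : ℝ) ^ (2 + δ) := by linarith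
            _ ≤ (n : ℝ) ^ (E * c₁ - 3 * δ / 2) * (n : ℝ) ^ (2 + δ) :=
                mul_le_mul_of_nonneg_right h16₂ hnδ0
      _ = (n : ℝ) * x := by rw [hnx]; ring
      _ ≤ (n : ℝ) * ((M : ℝ) * (8 * p)) := mul_le_mul_of_nonneg_left hMge hn0.le
      _ = ((n * M : ℕ) : ℝ) * (8 * p) := by push_cast; ring
  have key2 : 2 * (n : ℝ) ^ (E * (1 - γ / 2 - c₁)) ≤ ((n * M : ℕ) : ℝ) := by
    have h8p : (0 : ℝ) < 8 * p := by positivity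
    refine le_of_mul_le_mul_right ?_ h8p
    linarith [key]
  linarith [hdef, hup, hY0, key2]

end Summit.MatrixMultiplication.MatrixMultiplication.Theorems.PrimeTwoFamilies.SingleScaleDefectElementary
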